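import Mathlib
import Summits.ValiantsHypothesis.ValiantsHypothesis.Theses.NewtonUnitEquations
import Literature.Computability.AlgebraicComplexity.NewtonPolygonTau

/-!
# Sketch — crux idea `kinetic-filtered-envelope` (crux stmt-ValiantsHypothesis-5907 `DissociatedFixedK`,
round 1, ideator 3, gen 2)

First checkable statements of the line, over existing declarations.

* §1 `flip_dead_iff` — PROVED.  The k = 2 LOCALITY lemma: at a dead box top `b` of a two-term tensor
  `Π_l φ_l(b_l) + c·Π_l ψ_l(b_l) = 0`, a single-letter flip `b_j ↦ e` is again dead iff the flip is
  NEUTRAL, `ψ_j(e)·φ_j(b_j) = φ_j(e)·ψ_j(b_j)` — a condition on the two letters of coordinate `j` alone.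
  This is what makes the minimal reviving flip a COLOUR-FILTERED kinetic minimum ("allowed iff the
  ratio class of `e` differs from that of the current top letter"), hence amortisable along the slope.
* §2 `filteredEnvelope_lines` — the FILTERED ENVELOPE LEMMA (statement; proved on paper in the card,
  checked numerically by kit/filtered_envelope_check.py): for `N` coloured lines and a step labelling
  of the axis with `≤ M` jumps, the set of minimisers among the lines whose colour differs from the
  current label is constant on the cells of a set of `≤ 4N + M + 4` reals.
* §3 target-shaped statements: `TwoTermsNearLinear` (k = 2 of the crux with a bound of shape
  `C·(m+1)·(t+2)·(log₂(mt+2)+1)`), `BinomialPencilLinear` (the route's support item 5908 with `C·(m+1)`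
  in place of `C·(m+1)²`) with `binomialPencil_of_linear : BinomialPencilLinear → BinomialPencil`
  (PROVED), and the by-product conjecture `LinearInM`.
-/

namespace Summit.ValiantsHypothesis.ValiantsHypothesis.Cruxes.DissociatedFixedK.Ideator3g2

open Finset
open Literature.Computability.AlgebraicComplexity

/-! ## §1  k = 2 locality of deadness (PROVED) -/

/-- **Locality lemma (k = 2).** `φ ψ : Fin m → X → ℂ` are the letter-coefficient functions of the
two products (already multiplied by the outer weights), `b` a word alive for both products with
`Π φ(b) + c·Π ψ(b) = 0` (a dead box top), `e` a letter alive for `φ_j`.  Then the flipped word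
`b[j ↦ e]` is dead iff `ψ_j(e) φ_j(b_j) = φ_j(e) ψ_j(b_j)`. [folklore; this line's kinetic filter] -/
theorem flip_dead_iff {m : ℕ} {X : Type*} (φ ψ : Fin m → X → ℂ) (c : ℂ) (b : Fin m → X)
    (j : Fin m) (e : X) (hφ : ∀ l, φ l (b l) ≠ 0) (hψ : ∀ l, ψ l (b l) ≠ 0)
    (hdead : (∏ l, φ l (b l)) + c * ∏ l, ψ l (b l) = 0) :
    ((∏ l, φ l (Function.update b j e l)) + c * ∏ l, ψ l (Function.update b j e l) = 0) ↔
      ψ j e * φ j (b j) = φ j e * ψ j (b j) := by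
  classical
  set P : ℂ := ∏ l ∈ univ.erase j, φ l (b l) with hP
  set Q : ℂ := ∏ l ∈ univ.erase j, ψ l (b l) with hQ
  have hPne : P ≠ 0 := Finset.prod_ne_zero_iff.mpr (fun l _ => hφ l)
  have hQne : Q ≠ 0 := Finset.prod_ne_zero_iff.mpr (fun l _ => hψ l)
  -- products through the erased coordinate
  have eφb : ∏ l, φ l (b l) = φ j (b j) * P :=
    (Finset.mul_prod_erase univ (fun l => φ l (b l)) (mem_univ j)).symm
  have eψb : ∏ l, ψ l (b l) = ψ j (b j) * Q :=
    (Finset.mul_prod_erase univ (fun l => ψ l (b l)) (mem_univ j)).symm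
  have eφe : ∏ l, φ l (Function.update b j e l) = φ j e * P := by
    rw [← Finset.mul_prod_erase univ (fun l => φ l (Function.update b j e l)) (mem_univ j)]
    simp only [Function.update_self]
    congr 1
    apply Finset.prod_congr rfl
    intro l hl
    rw [Function.update_of_ne (Finset.ne_of_mem_erase hl)]
  have eψe : ∏ l, ψ l (Function.update b j e l) = ψ j e * Q := by
    rw [← Finset.mul_prod_erase univ (fun l => ψ l (Function.update b j e l)) (mem_univ j)]
    simp only [Function.update_self]
    congr 1
    apply Finset.prod_congr rfl
    intro l hl
    rw [Function.update_of_ne (Finset.ne_of_mem_erase hl)]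
  rw [eφb, eψb] at hdead
  rw [eφe, eψe]
  constructor
  · intro h
    have key : (ψ j e * φ j (b j) - φ j e * ψ j (b j)) * P = 0 := by
      linear_combination (ψ j e) * hdead - (ψ j (b j)) * h
    rcases mul_eq_zero.mp key with h' | h'
    · exact sub_eq_zero.mp h'
    · exact absurd h' hPne
  · intro heq
    have key : φ j (b j) * (φ j e * P + c * (ψ j e * Q)) = 0 := by
      linear_combination (φ j e) * hdead + (c * Q) * heq
    rcases mul_eq_zero.mp key with h' | h'
    · exact absurd h' (hφ j)
    · exact h'

/-! ## §2  The filtered envelope lemma (statement) -/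

/-- Two reals lie in the same cell of the finite set `S`. -/
def SameCell (S : Finset ℝ) (x y : ℝ) : Prop :=
  ∀ z ∈ S, (z < x ↔ z < y) ∧ (z ≤ x ↔ z ≤ y)

/-- The set of minimisers at `x` among the lines `i ↦ a i + x * s i` whose colour is not `θ`. -/
def filteredArgmin {N : ℕ} {ι : Type*} (a s : Fin N → ℝ) (col : Fin N → ι) (θ : ι) (x : ℝ) :
    Set (Fin N) :=
  {i | col i ≠ θ ∧ ∀ i', col i' ≠ θ → a i + x * s i ≤ a i' + x * s i'}

/-- **FILTERED ENVELOPE LEMMA (lines).**  `N` pairwise distinct lines with colours `col`, a labelling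
`lab : ℝ → ι` that is constant on the cells of some `Z` with `#Z ≤ M`.  Then the filtered minimiser set
`filteredArgmin a s col (lab x) x` is constant on the cells of a set `S` of at most `4N + M + 4` reals.
Proof (card): `S = Z ∪ bp(env) ∪ bp(E*)` where `E*` is the multichromatic second envelope
("lowest line whose colour differs from the floor's colour"), and `#bp(E*) ≤ 3N` because a line can sit
on `E*` above floors of at most TWO colours, in two blocks (a line that is ≥ ℓ, then < ℓ, then ≥ ℓ is
impossible).  [this card; checked numerically, kit/filtered_envelope_check.py] -/
theorem filteredEnvelope_lines {N M : ℕ} {ι : Type*} (a s : Fin N → ℝ) (col : Fin N → ι)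
    (hinj : Function.Injective fun i => (a i, s i)) (lab : ℝ → ι)
    (hlab : ∃ Z : Finset ℝ, Z.card ≤ M ∧ ∀ x y, SameCell Z x y → lab x = lab y) :
    ∃ S : Finset ℝ, S.card ≤ 4 * N + M + 4 ∧
      ∀ x y, SameCell S x y → filteredArgmin a s col (lab x) x = filteredArgmin a s col (lab y) y := by
  sorry

/-! ## §3  Target-shaped statements -/

/-- k = 2 NEAR-LINEAR bound in the dissociated regime (the card's Theorem for two products):
`#vert ≤ C·(m+1)·(t+2)·(log₂(mt+2)+1)` (the `log` stands in for the inverse-Ackermann factor of the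
Hart–Sharir segment-envelope bound; `t`, not `t²`, by the filtered envelope lemma inside each
coordinate). -/
def TwoTermsNearLinear : Prop :=
  ∃ C : ℕ, ∀ (m t : ℕ) (A : Fin m → Finset (Fin 2 →₀ ℕ)) (f : Fin 2 → Fin m → MvPolynomial (Fin 2) ℂ),
    (∀ j, (A j).card ≤ t) → (∀ i j, (f i j).support ⊆ A j) →
    (∀ a b : Fin m → (Fin 2 →₀ ℕ), (∀ j, a j ∈ A j) → (∀ j, b j ∈ A j) → ∑ j, a j = ∑ j, b j → a = b) →
    newtonVertexCount (∑ i, ∏ j, f i j) ≤ C * (m + 1) * (t + 2) * (Nat.log 2 (m * t + 2) + 1)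

/-- The route's support item `BinomialPencil` (stmt-5908) with a LINEAR bound `C·(m+1)` (filed: `C·(m+1)²`):
the cancelled vertex at slope `μ` is `d_{S_μ △ {j*(μ)}}` with `j*(μ) = argmin_{α_j ≠ β_j} |⟨w_μ, d_j⟩|`, a lower
envelope of `≤ m` V-shaped functions pairwise crossing ≤ 2 times: `≤ 2m − 1` pieces (DS order 2). -/
def BinomialPencilLinear : Prop :=
  ∃ C : ℕ, ∀ (m : ℕ) (d : Fin m → (Fin 2 →₀ ℕ)) (α β : Fin m → ℂ) (c : ℂ),
    (∀ S T : Finset (Fin m), ∑ j ∈ S, d j = ∑ j ∈ T, d j → S = T) → (∀ j, α j ≠ 0) → (∀ j, β j ≠ 0) →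
    (Set.extremePoints ℝ (convexHull ℝ ((fun e : Fin 2 →₀ ℕ => fun i : Fin 2 => ((e i : ℕ) : ℝ)) ''
      ((∏ j, (1 + MvPolynomial.C (α j) * MvPolynomial.monomial (d j) 1) -
        MvPolynomial.C c * ∏ j, (1 + MvPolynomial.C (β j) * MvPolynomial.monomial (d j) 1)).support :
          Set (Fin 2 →₀ ℕ))))).ncard ≤ C * (m + 1)

/-- The linear pencil bound discharges the filed support item (PROVED: `C(m+1) ≤ C(m+1)²`). -/
theorem binomialPencil_of_linear (h : BinomialPencilLinear) :
    Summit.ValiantsHypothesis.ValiantsHypothesis.Theses.NewtonUnitEquations.BinomialPencil := by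
  obtain ⟨C, hC⟩ := h
  refine ⟨C, ?_⟩
  intro m d α β c hd hα hβ
  refine (hC m d α β c hd hα hβ).trans ?_
  have h1 : m + 1 ≤ (m + 1) ^ 2 := by nlinarith
  exact Nat.mul_le_mul_left C h1

/-- By-product CONJECTURE `LinearInM` (recorded for the planner / sibling crux 5905, not load-bearing for
this crux): for every fixed `k` the vertex count is LINEAR in `m` — all `k`-dependence sits in the
multiplicative constant `g`, the exponent `c₀` of `t+2` is absolute.  (Digit grids, Disproof §C, force
`g(k) ≥ k / poly`; THEOREM Q of the sibling line gives only `m^{O(log k)}`; the cube count gives `m^k`.) -/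
def LinearInM : Prop :=
  ∃ c₀ : ℕ, ∀ k : ℕ, ∃ g : ℕ, ∀ (m t : ℕ) (A : Fin m → Finset (Fin 2 →₀ ℕ))
    (f : Fin k → Fin m → MvPolynomial (Fin 2) ℂ),
    (∀ j, (A j).card ≤ t) → (∀ i j, (f i j).support ⊆ A j) →
    (∀ a b : Fin m → (Fin 2 →₀ ℕ), (∀ j, a j ∈ A j) → (∀ j, b j ∈ A j) → ∑ j, a j = ∑ j, b j → a = b) →
    newtonVertexCount (∑ i, ∏ j, f i j) ≤ g * (m + 1) * (t + 2) ^ c₀ * (Nat.log 2 (m * t + 2) + 1)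

/-- Sanity: the crux decl this line concludes (by name; never restated). -/
example : Prop := Summit.ValiantsHypothesis.ValiantsHypothesis.Theses.NewtonUnitEquations.DissociatedFixedK

end Summit.ValiantsHypothesis.ValiantsHypothesis.Cruxes.DissociatedFixedK.Ideator3g2
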